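import Summits.RiemannHypothesis.RiemannHypothesis.Theses.SpectralTrace
import Summits.RiemannHypothesis.RiemannHypothesis.Theorems.SpectralTraceWindowStepWindowGrowthCalibration
import Summits.RiemannHypothesis.RiemannHypothesis.Theorems.SpectralTraceWindowTraceToPositivity
import Summits.RiemannHypothesis.RiemannHypothesis.Theorems.SpectralTraceWindowCompactness

/-!
# crux-plan `phase-family-flow` for the crux `WindowStep` (stmt-RiemannHypothesis-14659) — NO-SKELETON record

Planner `planner-cruxplan-stmt-RiemannHypothesis-14659-phase-family-flow-0`, 2026-08-16.
Evidence file (sorry-free, kernel-checked): the DILEMMA that makes the idea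
`Cruxes/WindowStep/Ideas/phase-family-flow.md` un-skeletonisable on THIS crux, spelled as theorems
over landed declarations only.

The crux is `WindowStep = ∀ n ≥ 2, Trace(log n) → Trace(log (n+1))`, and the landed negative lemma
`Theorems/WindowStep/Negative/Collapse.lean` gives `WindowStep ↔ (WindowTraceArch → RH)`.
The idea card declares `Transfer: none` (an ENGINE: Poisson summation along the level sets of the
Selberg–Gonek phase `Φ_X`, exact in the `j = 0` channel, plus a flow in the prime cutoff) and
delegates the RH-strength input ("surgery on the near-fold set `F⁺(n)` for every `n`") to the
companion card, whose line the lead has already built (`Lines/Sketch.lean`, held stub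
`stub_windowGrowth` ≡ RH, `windowGrowth_iff_riemannHypothesis`).  A concluding composition
`WindowStep_of : stub₁ → … → stub_k → WindowStep` for THIS idea must therefore import an
RH-strength stub in one of the two currencies that exist on this crux:

* HORN 1 — positivity climbing (`PositivityStep`, the Weil-form currency of the lead's held stub):
  `windowStep_of_positivityStep` below shows that such a stub ALONE concludes the crux through
  landed theorems (`riemannHypothesis_iff_positivityStep`, Collapse `←`), so every phase-family stub
  placed beside it (PhasePoisson, alias expansion, FlowStep, TopSynthesis) is logically idle —
  the COSTUME defect ("the crux sliced so all difficulty hides in one step", the rest decorative),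
  and the line would coincide with `Sketch` at its only load-bearing stub.
* HORN 2 — outright synthesis of every rung from the Gonek seed (`RungSynthesis`): the hypothesis
  `Trace(log n)` is then unused (`windowStep_of_rungSynthesis`), the stub is RH by itself
  (`riemannHypothesis_of_rungSynthesis`), and per rung it is at least as hard as the positivity
  rung the lead already holds (`positivityRung_of_rungSynthesis`: `Trace(log (n+1)) →
  WeilPositivityOn ((log (n+1))/2)`, landed `windowTraceToPositivity_proof`) — a DOMINATED transfer;
  its frozen-far-field form is false (the alias defect of the phase family is stationary near every
  height `2πr·e^{∓x}`, `r` `X`-smooth — TRIAGE-r1-1 and TRIAGE-r1-3), and its displaced form is the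
  `WindowTraceArch` line architecture (`Lines/poisson_density_newton_kantorovich.lean`:
  `stub_densityChannel` + `stub_windowSynthesis` + NK) repeated at every rung, whose `n = 2`
  instance is the open tier-deciding crux.

Hence no honest 2–7-stub skeleton exists for `phase-family-flow` on `WindowStep`; its TRUE lemmas are
re-homed (see `Lines/phase-family-flow.md`): the corrected, non-vacuous Poisson-along-level-sets
statement is typed below as `PhasePoissonLocal` (smooth = `ContDiff ℝ ∞`, NOT `ContDiff ℝ ⊤ = C^ω`,
which made the ideator's version trivially true — TRIAGE-r1-2 and TRIAGE-r1-3 `phasePoisson_trivial`).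
-/

set_option linter.dupNamespace false

noncomputable section

open Complex Set MeasureTheory
open scoped Real ContDiff

namespace Summit.RiemannHypothesis.RiemannHypothesis.Cruxes.WindowStep.PhaseFamilyFlow

open Literature.NumberTheory.LFunctions
open Summit.RiemannHypothesis.RiemannHypothesis.Theses.SpectralTrace

/-- File-local spelling of `Trace(A)` (the common shape of `WindowTraceArch`, `WindowStep`, …):
a notation, not a definition. -/
local notation3 "WTrace " A:max => ∃ (ι : Type) (γ : ι → ℝ), ∀ g : ℝ → ℂ, IsWeilTest g →
  tsupport g ⊆ Set.Icc (-A) A →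
    HasSum (fun i => weilMellin g (1 / 2 + (γ i : ℂ) * I)) (weilFunctional g)

/-! ## The Collapse facts used (re-derived inline from built modules; the landed source is
`Theorems/WindowStep/Negative/Collapse.lean`, whose olean the farm had not built at check time) -/

/-- Window antitonicity: a family for `[-A', A']` serves `[-A, A]`, `A ≤ A'`
(Collapse `windowTrace_anti`). [folklore] -/
theorem windowTrace_anti {A A' : ℝ} (hAA' : A ≤ A') (h : WTrace A') : WTrace A := by
  obtain ⟨ι, γ, hγ⟩ := h
  exact ⟨ι, γ, fun g hg hgs => hγ g hg (hgs.trans (Icc_subset_Icc (neg_le_neg hAA') hAA'))⟩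

/-- Any rung `Trace(log n)`, `n ≥ 2`, contains the seed `WindowTraceArch` (Collapse `seed_of_rung`).
[folklore] -/
theorem seed_of_rung {n : ℕ} (hn : 2 ≤ n) (h : WTrace (Real.log n)) : WindowTraceArch :=
  windowTrace_anti (Real.log_le_log (by norm_num) (by exact_mod_cast hn)) h

/-- Seed + step ⇒ every integer rung (Collapse `rungs_of_windowTraceArch_of_windowStep`). [folklore] -/
theorem rungs_of_seed_of_step (hArch : WindowTraceArch) (hStep : WindowStep) :
    ∀ n : ℕ, 2 ≤ n → WTrace (Real.log n) := by
  intro n hn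
  induction n, hn using Nat.le_induction with
  | base =>
    simp only [Nat.cast_ofNat]
    exact hArch
  | succ k hk ih =>
    rw [Nat.cast_succ]
    exact hStep k hk ih

/-- Seed + step ⇒ RH (Collapse `riemannHypothesis_of_windowTraceArch_of_windowStep`, via the landed
`riemannHypothesis_of_ladder`). [folklore] -/
theorem riemannHypothesis_of_seed_of_step (hArch : WindowTraceArch) (hStep : WindowStep) :
    _root_.RiemannHypothesis := by
  refine Summit.RiemannHypothesis.RiemannHypothesis.Theorems.riemannHypothesis_of_ladder fun A _ => ?_
  obtain ⟨n, hn⟩ := exists_nat_ge (Real.exp A)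
  refine windowTrace_anti ?_ (rungs_of_seed_of_step hArch hStep (n + 2) (by omega))
  rw [Real.le_log_iff_exp_le (by positivity)]
  push_cast
  linarith

/-- `(WindowTraceArch → RH) → WindowStep` (the `←` half of Collapse
`windowStep_iff_windowTraceArch_imp_riemannHypothesis`): the hypothesis `Trace(log n)` contains the
seed, hence RH, hence every window (`spectralThesis_of_riemannHypothesis`, landed). [folklore] -/
theorem windowStep_of_arch_imp_rh (h : WindowTraceArch → _root_.RiemannHypothesis) : WindowStep := by
  intro n hn hTn
  obtain ⟨ι, γ, hγ⟩ :=
    Summit.RiemannHypothesis.RiemannHypothesis.Theorems.spectralThesis_of_riemannHypothesis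
      (h (seed_of_rung hn hTn))
  exact ⟨ι, γ, fun g hg _ => hγ g hg⟩

/-! ## Horn 1 — a positivity-climb stub makes every synthesis stub idle -/

/-- The positivity climb on half windows: the Weil-form currency of the RH-strength input on this
crux (≡ RH, `riemannHypothesis_iff_positivityStep`, landed; the lead's `stub_windowGrowth` is its
density form). -/
def PositivityStep : Prop :=
  ∀ n : ℕ, 2 ≤ n → WeilPositivityOn (Real.log n / 2) → WeilPositivityOn (Real.log ((n : ℝ) + 1) / 2)

/-- **Horn 1.** A positivity-climb stub ALONE concludes the crux, through landed theorems only
(`riemannHypothesis_iff_positivityStep`, then the Collapse direction `(Arch → RH) → WindowStep`):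
no synthesis / Poisson / flow stub is needed beside it, so in any skeleton
`stub_positivity… → stub_phasePoisson → … → WindowStep` the phase-family stubs are decorative.
[folklore] -/
theorem windowStep_of_positivityStep (h : PositivityStep) : WindowStep :=
  windowStep_of_arch_imp_rh fun _ =>
    Summit.RiemannHypothesis.RiemannHypothesis.Theorems.SpectralTraceWindowStep.riemannHypothesis_iff_positivityStep.2
      h

/-- Conversely the crux together with the seed gives the positivity climb (so on this crux the
climb is not an extra assumption but the whole content, modulo the seed). [folklore] -/
theorem positivityStep_of_windowStep (hArch : WindowTraceArch) (hStep : WindowStep) :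
    PositivityStep :=
  Summit.RiemannHypothesis.RiemannHypothesis.Theorems.SpectralTraceWindowStep.riemannHypothesis_iff_positivityStep.1
    (riemannHypothesis_of_seed_of_step hArch hStep)

/-! ## Horn 2 — outright rung synthesis ignores the hypothesis, is RH, and is dominated per rung -/

/-- Outright synthesis of every rung `Trace(log (n+1))`, `n ≥ 2` — what the phase-family engine
(Gonek seed at cutoff `X = n`, alias healing, fold surgery) would have to deliver, since it
transports the canonical phase family and never uses the GIVEN rung-`n` family. -/
def RungSynthesis : Prop :=
  ∀ n : ℕ, 2 ≤ n → WTrace (Real.log ((n : ℝ) + 1))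

/-- **Horn 2a.** Rung synthesis concludes the crux with the hypothesis `Trace(log n)` UNUSED.
[folklore] -/
theorem windowStep_of_rungSynthesis (h : RungSynthesis) : WindowStep :=
  fun n hn _ => h n hn

/-- **Horn 2b.** Rung synthesis is RH by itself: rung `3` contains the seed (window antitonicity,
`seed_of_rung`), and seed + step is RH (Collapse). [folklore] -/
theorem riemannHypothesis_of_rungSynthesis (h : RungSynthesis) : _root_.RiemannHypothesis := by
  have h3 : WTrace (Real.log ((3 : ℕ) : ℝ)) := by
    have h2 := h 2 le_rfl
    norm_num at h2 ⊢
    exact h2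
  exact riemannHypothesis_of_seed_of_step (seed_of_rung (by norm_num) h3)
    (windowStep_of_rungSynthesis h)

/-- **Horn 2c (dominance).** Per rung, synthesis is at least as hard as the positivity rung the
lead's line already holds: `Trace(log (n+1)) → WeilPositivityOn ((log (n+1))/2)`
(`windowTraceToPositivity_proof`, landed). So as a transfer of the RH-strength input, "exact unit-atom
synthesis at every rung" is dominated by "positivity at every rung". [folklore] -/
theorem positivityRung_of_rungSynthesis (h : RungSynthesis) :
    ∀ n : ℕ, 2 ≤ n → WeilPositivityOn (Real.log ((n : ℝ) + 1) / 2) :=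
  fun n hn =>
    Summit.RiemannHypothesis.RiemannHypothesis.Theorems.windowTraceToPositivity_proof _ (h n hn)

/-- The two horns meet: rung synthesis gives the positivity climb outright (conclusion of the
climb at every rung, hypothesis discarded). [folklore] -/
theorem positivityStep_of_rungSynthesis (h : RungSynthesis) : PositivityStep :=
  fun n hn _ => positivityRung_of_rungSynthesis h n hn

/-! ## Re-homed lemma, typed correctly (NOT asserted here): Poisson summation along level sets -/

/-- **PhasePoissonLocal** — the idea's First lemma in non-vacuous form (for the `WindowTraceArch`
density-channel stub, not for this crux). For a smooth (`C^∞`, i.e. `ContDiff ℝ ∞` — the ideator's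
`ContDiff ℝ ⊤` means real-analytic in current Mathlib and forces a compactly supported `F` to vanish)
phase `Φ` with inverse `Ψ` and positive derivative, and a smooth compactly supported `F`, the unit
atoms at the half-integer levels `Φ(t_k) = π(k − ½)` satisfy
`Σ_k F(t_k) = Σ_{j∈ℤ} (−1)^j ∫ F(t) (Φ'(t)/π) e^{−2ijΦ(t)} dt`
(Poisson summation `Real.tsum_eq_tsum_fourier` in the variable `u = Φ(t)/π + ½`; the `j = 0` term is
`∫ F Φ'/π`, the density channel). To use it on the Gonek phase `Φ_X = θ − Σ_{m≤X} Λ(m) m^{-1/2}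
(log m)^{-1} sin(t log m)`, which is NOT monotone on the fold set nor for `t < 2π`, one first
modifies `Φ_X` off `tsupport F` (localisation) — the statement below is the global-monotone lemma
that such a use invokes. -/
def PhasePoissonLocal : Prop :=
  ∀ (Φ Ψ : ℝ → ℝ) (F : ℝ → ℂ), ContDiff ℝ ∞ Φ → (∀ t, 0 < deriv Φ t) →
    (∀ t, Ψ (Φ t) = t) → (∀ u, Φ (Ψ u) = u) → ContDiff ℝ ∞ F → HasCompactSupport F →
      HasSum (fun k : ℤ => F (Ψ (π * ((k : ℝ) - 1 / 2))))
        (∑' j : ℤ, (-1 : ℂ) ^ j *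
          ∫ t : ℝ, F t * ((deriv Φ t / π : ℝ) : ℂ) * cexp (-(2 * (j : ℂ) * (Φ t : ℂ) * I)))

end Summit.RiemannHypothesis.RiemannHypothesis.Cruxes.WindowStep.PhaseFamilyFlow

end
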